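import Mathlib
import Summits.MatrixMultiplication.Statement

/-!
# Graph equations — stage algebra of the multiplicity-reduction tower (M23b)

Generic algebra consumed by the generic-point tower that is to supply the m-fold tower data of
`GraphEquationsTowerAssembly` (the binder `hS1` of `familyRung_of_towerSupply`).  The tower is the
PIVOT-NORMALISED IDENTITY tower: at stage `j` every fibre coordinate `x` gets its own fresh variable
`λ_x`, the stage derivation is `D_j = ∑_x λ_x ∂_x` (cost-free values), the kernel point is pinned by
normalisers `λ_x - w_x` (`x` in a coordinate set `S_j` on which the kernel projects isomorphically,
`w ∈ ℂ^{S_j}` constants), and the exponent bookkeeping is done with DENOMINATORS in the polynomial ring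
(no local rings, no Nakayama, no random mixing matrices).  This module proves the stage lemmas in that
currency; no new definitions.

* §1 derivations on `MvPolynomial`: the chain rule `D p = ∑ i, ∂_i p * D (X i)`, its evaluated form,
  transport of a derivation along `rename`, `D (span S) ⊆ span (S ∪ D '' S)`, and the exponent drop
  with denominators `u * x ^ e ∈ J ⟹ (e * u * u * D x) * x ^ (e - 1) ∈ J'`;
* §2 rows (gradients at a point) of ideal members lie in the span of the rows of the generators;
* §3 linear algebra in `K^X`: every subspace has a coordinate set on which it projects isomorphically,
  the dot-annihilator test for `e_q ∉ span Rows`, and `span (Rows ∪ {e_x : x ∈ S}) = ⊤`;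
* §4 constants in `ℂ^S ⊆ K^S` avoiding finitely many non-zero `K`-linear functionals.
-/

set_option linter.dupNamespace false

noncomputable section

open scoped BigOperators

namespace Summit.MatrixMultiplication.MatrixMultiplication.Theorems.GraphEquations

open MvPolynomial

/-! ## §1 Derivations on polynomial rings -/

section Derivations

variable {R : Type*} [CommRing R] {σ : Type*}

/-- **Chain rule.** A derivation of a polynomial ring in finitely many variables is determined by
its values on the variables: `D p = ∑ i, ∂_i p * D (X i)`. -/
theorem derivation_apply_eq_sum_pderiv [Fintype σ]
    (D : Derivation R (MvPolynomial σ R) (MvPolynomial σ R)) (p : MvPolynomial σ R) :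
    D p = ∑ i, pderiv i p * D (X i) := by
  classical
  induction p using MvPolynomial.induction_on with
  | C a => simp [MvPolynomial.derivation_C]
  | add p q hp hq => simp only [map_add, hp, hq, add_mul, Finset.sum_add_distrib]
  | mul_X p j hp =>
    have hX : ∀ i, pderiv i (X j : MvPolynomial σ R) = if j = i then 1 else 0 := fun i => by
      rw [pderiv_X, Pi.single_apply]
    rw [Derivation.leibniz, smul_eq_mul, smul_eq_mul, hp]
    simp_rw [pderiv_mul, hX, add_mul, Finset.sum_add_distrib]
    have h1 : ∑ i, p * (if j = i then (1 : MvPolynomial σ R) else 0) * D (X i) = p * D (X j) := by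
      rw [Finset.sum_eq_single j (fun i _ hij => by rw [if_neg (Ne.symm hij), mul_zero, zero_mul])
        (fun h => absurd (Finset.mem_univ j) h), if_pos rfl, mul_one]
    rw [h1, Finset.mul_sum, add_comm]
    congr 1
    exact Finset.sum_congr rfl fun i _ => by ring

/-- **Evaluated chain rule.** -/
theorem aeval_derivation_eq_sum [Fintype σ] {S : Type*} [CommRing S] [Algebra R S] (pt : σ → S)
    (D : Derivation R (MvPolynomial σ R) (MvPolynomial σ R)) (p : MvPolynomial σ R) :
    aeval pt (D p) = ∑ i, aeval pt (pderiv i p) * aeval pt (D (X i)) := by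
  rw [derivation_apply_eq_sum_pderiv D p, map_sum]
  exact Finset.sum_congr rfl fun i _ => by rw [map_mul]

/-- **Evaluated chain rule, annihilated point.** If the vector of values `(D (X i))(pt)` is
annihilated by the gradient of `p` at `pt`, then `(D p)(pt) = 0`. -/
theorem aeval_derivation_eq_zero_of_sum_eq_zero [Fintype σ] {S : Type*} [CommRing S] [Algebra R S]
    (pt : σ → S) (D : Derivation R (MvPolynomial σ R) (MvPolynomial σ R)) (p : MvPolynomial σ R)
    (h : ∑ i, aeval pt (pderiv i p) * aeval pt (D (X i)) = 0) : aeval pt (D p) = 0 := by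
  rw [aeval_derivation_eq_sum, h]

/-- **Transport along `rename`.** If `g` extends the values of `D` along `f`
(`g (f i) = rename f (D (X i))`), then `mkDerivation R g` restricted to the image of `rename f`
is `D`: `mkDerivation R g (rename f p) = rename f (D p)`. -/
theorem mkDerivation_rename_eq {τ : Type*} (f : σ → τ)
    (D : Derivation R (MvPolynomial σ R) (MvPolynomial σ R)) (g : τ → MvPolynomial τ R)
    (hg : ∀ i, g (f i) = rename f (D (X i))) (p : MvPolynomial σ R) :
    mkDerivation R g (rename f p) = rename f (D p) := by
  induction p using MvPolynomial.induction_on with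
  | C a => rw [rename_C, MvPolynomial.derivation_C, MvPolynomial.derivation_C, map_zero]
  | add p q hp hq => rw [map_add, map_add, hp, hq, map_add, map_add]
  | mul_X p j hp =>
    rw [map_mul, rename_X, Derivation.leibniz, Derivation.leibniz, mkDerivation_X, hp, hg,
      smul_eq_mul, smul_eq_mul, smul_eq_mul, smul_eq_mul, map_add, map_mul, map_mul, rename_X]

/-- **Derivatives of an ideal stay in the ideal generated by the generators and their
derivatives.** -/
theorem derivation_apply_mem_span_union {A : Type*} [CommRing A] [Algebra R A]
    (D : Derivation R A A) {S : Set A} {p : A} (hp : p ∈ Ideal.span S) :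
    D p ∈ Ideal.span (S ∪ D '' S) := by
  induction hp using Submodule.span_induction with
  | mem s hs => exact Ideal.subset_span (Or.inr ⟨s, hs, rfl⟩)
  | zero => rw [map_zero]; exact Ideal.zero_mem _
  | add p q _ _ hp hq => rw [map_add]; exact Ideal.add_mem _ hp hq
  | smul a p hp' hp =>
    rw [smul_eq_mul, Derivation.leibniz, smul_eq_mul, smul_eq_mul]
    refine Ideal.add_mem _ (Ideal.mul_mem_left _ _ hp) (Ideal.mul_mem_right _ _ ?_)
    exact Ideal.span_mono Set.subset_union_left hp'

/-- **Exponent drop with denominators.** If `u * x ^ e ∈ J` (`e ≥ 1`), `J ≤ J'` and `D J ⊆ J'`, then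
`(e * u * u * D x) * x ^ (e - 1) ∈ J'`.  (At a point where `u` and `D x` do not vanish the new
multiplier does not vanish either: this is the local statement `x ^ (e-1) ∈ J' O`.) -/
theorem pow_pred_mem_of_derivation_denom {A : Type*} [CommRing A] [Algebra R A]
    (D : Derivation R A A) {J J' : Ideal A} (hJJ' : J ≤ J') (hD : ∀ p ∈ J, D p ∈ J')
    {u x : A} {e : ℕ} (hux : u * x ^ e ∈ J) :
    (e : A) * u * u * D x * x ^ (e - 1) ∈ J' := by
  have key : (e : A) * u * u * D x * x ^ (e - 1) = u * D (u * x ^ e) - D u * (u * x ^ e) := by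
    rw [Derivation.leibniz, Derivation.leibniz_pow]
    simp only [smul_eq_mul, nsmul_eq_mul]
    ring
  rw [key]
  exact J'.sub_mem (J'.mul_mem_left _ (hD _ hux)) (J'.mul_mem_left _ (hJJ' hux))

/-- **Iterating a cost-free derivation list preserves membership in an ideal closed under them.**
If `D g ∈ I` for every `g ∈ I` and every `D ∈ Ds`, then every fold of `Ds` maps `I` into `I`. -/
theorem foldl_mem_of_forall_mem {A : Type*} [CommRing A] [Algebra R A] {I : Ideal A}
    (Ds : List (Derivation R A A)) (hDs : ∀ D ∈ Ds, ∀ g ∈ I, D g ∈ I) {g : A} (hg : g ∈ I) :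
    Ds.foldl (fun acc D => D acc) g ∈ I := by
  induction Ds generalizing g with
  | nil => exact hg
  | cons D Ds ih =>
    exact ih (fun D' hD' => hDs D' (List.mem_cons_of_mem _ hD')) (hDs D List.mem_cons_self g hg)

end Derivations

/-! ## §2 Rows of ideal members at a zero of the ideal -/

section Rows

variable {R : Type*} [CommRing R] {K : Type*} [Field K] [Algebra R K] {σ X : Type*}

/-- The evaluation at `pt` vanishes on the ideal generated by polynomials vanishing at `pt`. -/
theorem aeval_eq_zero_of_mem_span (pt : σ → K) {S : Set (MvPolynomial σ R)}
    (hS : ∀ s ∈ S, aeval pt s = 0) {g : MvPolynomial σ R} (hg : g ∈ Ideal.span S) :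
    aeval pt g = 0 := by
  have : Ideal.span S ≤ RingHom.ker (aeval pt).toRingHom := Ideal.span_le.mpr fun s hs => hS s hs
  exact this hg

/-- **Rows of ideal members.** If every generator `s ∈ S` vanishes at `pt`, then the row
`(∂_{φ y} g)(pt)` of any `g ∈ span S` lies in the `K`-span of the rows of the generators. -/
theorem row_mem_span_rows (pt : σ → K) (φ : X → σ) {S : Set (MvPolynomial σ R)}
    (hS : ∀ s ∈ S, aeval pt s = 0) {g : MvPolynomial σ R} (hg : g ∈ Ideal.span S) :
    (fun y => aeval pt (pderiv (φ y) g)) ∈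
      Submodule.span K ((fun s => fun y => aeval pt (pderiv (φ y) s)) '' S) := by
  induction hg using Submodule.span_induction with
  | mem s hs => exact Submodule.subset_span ⟨s, hs, rfl⟩
  | zero =>
    have : (fun y => aeval pt (pderiv (φ y) (0 : MvPolynomial σ R))) = 0 := by
      funext y; simp
    rw [this]; exact Submodule.zero_mem _
  | add p q _ _ hp hq =>
    have : (fun y => aeval pt (pderiv (φ y) (p + q))) =
        (fun y => aeval pt (pderiv (φ y) p)) + fun y => aeval pt (pderiv (φ y) q) := by
      funext y; simp [map_add]
    rw [this]; exact Submodule.add_mem _ hp hq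
  | smul a p hp' hp =>
    have hp0 : aeval pt p = 0 := aeval_eq_zero_of_mem_span pt hS hp'
    have : (fun y => aeval pt (pderiv (φ y) (a • p))) =
        aeval pt a • fun y => aeval pt (pderiv (φ y) p) := by
      funext y
      simp only [smul_eq_mul, pderiv_mul, map_add, map_mul, hp0, mul_zero, zero_add,
        Pi.smul_apply]
    rw [this]; exact Submodule.smul_mem _ _ hp

/-- **Row of a multiple of a vanishing polynomial.** -/
theorem row_mul_of_aeval_eq_zero (pt : σ → K) (φ : X → σ) {w F : MvPolynomial σ R}
    (hF : aeval pt F = 0) :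
    (fun y => aeval pt (pderiv (φ y) (w * F))) = aeval pt w • fun y => aeval pt (pderiv (φ y) F) := by
  funext y
  simp only [pderiv_mul, map_add, map_mul, hF, mul_zero, zero_add, Pi.smul_apply, smul_eq_mul]

end Rows

/-! ## §3 Linear algebra in `K^X` -/

section LinearAlgebra

variable {K : Type*} [Field K] {X : Type*} [Fintype X] [DecidableEq X]

/-- A linear functional on `K^X` is the dot product with its values on the standard basis. -/
theorem dual_apply_eq_sum (f : Module.Dual K (X → K)) (v : X → K) :
    f v = ∑ x, v x * f (fun y => if x = y then 1 else 0) := by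
  rw [LinearMap.pi_apply_eq_sum_univ f v]
  exact Finset.sum_congr rfl fun x _ => smul_eq_mul _ _

/-- **Dot-annihilator test.** If `v ∉ span Rows`, some vector annihilating every row does not
annihilate `v`. -/
theorem exists_dotAnnihilator_of_notMem_span {Rows : Set (X → K)} {v : X → K}
    (hv : v ∉ Submodule.span K Rows) :
    ∃ δ : X → K, (∀ r ∈ Rows, ∑ x, r x * δ x = 0) ∧ ∑ x, v x * δ x ≠ 0 := by
  obtain ⟨f, hfv, hf⟩ := Submodule.exists_dual_map_eq_bot_of_notMem hv inferInstance
  refine ⟨fun x => f (fun y => if x = y then 1 else 0), fun r hr => ?_, ?_⟩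
  · rw [← dual_apply_eq_sum f r]
    have : f r ∈ (Submodule.span K Rows).map f := Submodule.mem_map_of_mem (Submodule.subset_span hr)
    rw [hf] at this
    exact (Submodule.mem_bot K).mp this
  · rw [← dual_apply_eq_sum f v]; exact hfv

/-- **Free test.** If `e_q ∉ span Rows`, some dot-annihilator of the rows has a non-zero `q`-th
coordinate. -/
theorem exists_dotAnnihilator_apply_ne_zero {Rows : Set (X → K)} {q : X}
    (hq : (Pi.single q 1 : X → K) ∉ Submodule.span K Rows) :
    ∃ δ : X → K, (∀ r ∈ Rows, ∑ x, r x * δ x = 0) ∧ δ q ≠ 0 := by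
  obtain ⟨δ, hδ, hv⟩ := exists_dotAnnihilator_of_notMem_span hq
  refine ⟨δ, hδ, ?_⟩
  rwa [Finset.sum_eq_single q (fun x _ hx => by rw [Pi.single_eq_of_ne hx, zero_mul])
    (fun h => absurd (Finset.mem_univ q) h), Pi.single_eq_same, one_mul] at hv

/-- **Spanning test.** If the only dot-annihilator of `Rows` vanishing on `S` is `0`, then the rows
together with the standard vectors `e_x` (`x ∈ S`) span `K^X`. -/
theorem span_rows_union_single_eq_top {Rows : Set (X → K)} {S : Finset X}
    (hS : ∀ δ : X → K, (∀ r ∈ Rows, ∑ x, r x * δ x = 0) → (∀ x ∈ S, δ x = 0) → δ = 0) :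
    Submodule.span K (Rows ∪ (fun x => (Pi.single x 1 : X → K)) '' ↑S) = ⊤ := by
  by_contra hne
  obtain ⟨f, hf0, hf⟩ := Submodule.exists_dual_map_eq_bot_of_lt_top (lt_top_iff_ne_top.mpr hne)
    inferInstance
  have hkill : ∀ v ∈ Rows ∪ (fun x => (Pi.single x 1 : X → K)) '' ↑S, f v = 0 := by
    intro v hv
    have : f v ∈ (Submodule.span K _).map f := Submodule.mem_map_of_mem (Submodule.subset_span hv)
    rw [hf] at this
    exact (Submodule.mem_bot K).mp this
  set δ : X → K := fun x => f (fun y => if x = y then 1 else 0) with hδ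
  have hδ0 : δ = 0 := by
    refine hS δ (fun r hr => ?_) (fun x hx => ?_)
    · rw [← dual_apply_eq_sum f r]; exact hkill r (Or.inl hr)
    · have h1 : f (Pi.single x 1) = 0 := hkill _ (Or.inr ⟨x, hx, rfl⟩)
      have : (Pi.single x 1 : X → K) = fun y => if x = y then 1 else 0 := by
        funext y; rw [Pi.single_apply]; simp only [eq_comm]
      rw [this] at h1; exact h1
  apply hf0
  refine LinearMap.ext fun v => ?_
  rw [dual_apply_eq_sum f v, LinearMap.zero_apply]
  exact Finset.sum_eq_zero fun x _ => by
    have : δ x = 0 := by rw [hδ0]; rfl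
    rw [show f (fun y => if x = y then 1 else 0) = δ x from rfl, this, mul_zero]

/-- **Coordinate sets of a subspace.** Every subspace `N ⊆ K^X` has a set of coordinates `S` on
which it projects ISOMORPHICALLY: an element of `N` vanishing on `S` is `0`, and every assignment of
values on `S` is realised by an element of `N`. -/
theorem exists_coords_of_submodule (N : Submodule K (X → K)) :
    ∃ S : Finset X, (∀ δ ∈ N, (∀ x ∈ S, δ x = 0) → δ = 0) ∧
      (∀ w : X → K, ∃ δ ∈ N, ∀ x ∈ S, δ x = w x) := by
  classical
  -- `T` ranges over coordinate sets with `N ∩ K^T = 0`; take one of maximal cardinality.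
  let good : Finset (Finset X) :=
    Finset.univ.filter fun T => ∀ δ ∈ N, (∀ x, x ∉ T → δ x = 0) → δ = 0
  have hgood : ∀ T, T ∈ good ↔ ∀ δ ∈ N, (∀ x, x ∉ T → δ x = 0) → δ = 0 := fun T => by
    simp [good]
  have hne : good.Nonempty := ⟨∅, (hgood ∅).mpr fun δ _ h => funext fun x => h x (by simp)⟩
  obtain ⟨T, hT, hmax⟩ := Finset.exists_max_image good Finset.card hne
  rw [hgood] at hT
  -- every standard vector `e_y` is in `N + K^T`
  have hcol : ∀ y, y ∉ T → ∃ δ ∈ N, ∀ x, x ∉ T → δ x = if x = y then 1 else 0 := by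
    intro y hyT
    by_contra hno
    push Not at hno
    have hT' : insert y T ∈ good := by
      rw [hgood]
      intro δ hδN hδ
      by_cases hy : δ y = 0
      · exact hT δ hδN fun x hx => by
          by_cases hxy : x = y
          · rw [hxy]; exact hy
          · exact hδ x (by simp [hxy, hx])
      · obtain ⟨x, hxT, hx⟩ := hno ((δ y)⁻¹ • δ) (N.smul_mem _ hδN)
        refine absurd ?_ hx
        by_cases hxy : x = y
        · subst hxy; rw [if_pos rfl, Pi.smul_apply, smul_eq_mul, inv_mul_cancel₀ hy]
        · rw [if_neg hxy, Pi.smul_apply, smul_eq_mul, hδ x (by simp [hxy, hxT]), mul_zero]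
    have := hmax _ hT'
    rw [Finset.card_insert_of_notMem hyT] at this
    omega
  refine ⟨Finset.univ.filter fun x => x ∉ T, fun δ hδN hδ => hT δ hδN fun x hx =>
    hδ x (by simp [hx]), fun w => ?_⟩
  choose! δ hδN hδv using hcol
  refine ⟨∑ y ∈ Finset.univ.filter (fun y => y ∉ T), w y • δ y,
    N.sum_mem fun y hy => N.smul_mem _ (hδN y (by simpa using hy)), fun x hx => ?_⟩
  have hxT : x ∉ T := by simpa using hx
  rw [Finset.sum_apply, Finset.sum_eq_single x]
  · rw [Pi.smul_apply, smul_eq_mul, hδv x hxT x hxT, if_pos rfl, mul_one]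
  · intro y hy hyx
    rw [Pi.smul_apply, smul_eq_mul, hδv y (by simpa using hy) x hxT, if_neg (Ne.symm hyx), mul_zero]
  · intro h; exact absurd hx h

/-- **Linear kernel section.** For any set of rows there are a coordinate set `S` and a LINEAR map
`Ψ : K^X → K^X` such that `Ψ w` annihilates every row, agrees with `w` on `S`, and is the only
annihilator doing so (`Ψ w` depends only on `w|_S`; the stage's kernel point is `Ψ w` for constants
`w`, pinned by the normalisers `λ_x - w_x`, `x ∈ S`). -/
theorem exists_kernelSection_linear (Rows : Set (X → K)) :
    ∃ (S : Finset X) (Ψ : (X → K) →ₗ[K] (X → K)),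
      (∀ w, ∀ r ∈ Rows, ∑ x, r x * Ψ w x = 0) ∧ (∀ w, ∀ x ∈ S, Ψ w x = w x) ∧
      (∀ δ : X → K, (∀ r ∈ Rows, ∑ x, r x * δ x = 0) → (∀ x ∈ S, δ x = 0) → δ = 0) := by
  classical
  let N : Submodule K (X → K) :=
    { carrier := {δ | ∀ r ∈ Rows, ∑ x, r x * δ x = 0}
      add_mem' := fun {δ δ'} hδ hδ' r hr => by
        have h1 := hδ r hr
        have h2 := hδ' r hr
        simp only [Pi.add_apply, mul_add, Finset.sum_add_distrib, h1, h2, add_zero]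
      zero_mem' := fun r _ => by simp
      smul_mem' := fun c δ hδ r hr => by
        have h1 := hδ r hr
        simp only [Pi.smul_apply, smul_eq_mul, mul_left_comm _ c, ← Finset.mul_sum, h1, mul_zero] }
  have hN : ∀ δ, δ ∈ N ↔ ∀ r ∈ Rows, ∑ x, r x * δ x = 0 := fun δ => Iff.rfl
  obtain ⟨S, h1, h2⟩ := exists_coords_of_submodule N
  have huniq : ∀ δ δ' : X → K, δ ∈ N → δ' ∈ N → (∀ x ∈ S, δ x = δ' x) → δ = δ' := by
    intro δ δ' hδ hδ' h
    have := h1 (δ - δ') (N.sub_mem hδ hδ') fun x hx => by rw [Pi.sub_apply, h x hx, sub_self]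
    exact sub_eq_zero.mp this
  choose Ψf hΨN hΨS using h2
  refine ⟨S,
    { toFun := Ψf
      map_add' := fun w w' => huniq _ _ (hΨN _) (N.add_mem (hΨN w) (hΨN w')) fun x hx => by
        rw [hΨS _ x hx, Pi.add_apply, Pi.add_apply, hΨS w x hx, hΨS w' x hx]
      map_smul' := fun c w => huniq _ _ (hΨN _) (N.smul_mem c (hΨN w)) fun x hx => by
        rw [hΨS _ x hx, RingHom.id_apply, Pi.smul_apply, Pi.smul_apply, hΨS w x hx] },
    fun w => (hN _).mp (hΨN w), fun w => hΨS w, fun δ hδ hS => h1 δ ((hN δ).mpr hδ) hS⟩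

end LinearAlgebra

/-! ## §4 Constants avoiding finitely many non-zero functionals -/

section Avoid

variable {K : Type*} [Field K] {S : Type*} [Fintype S] [DecidableEq S]

/-- A non-zero linear functional on `K^S` is non-zero on some standard vector. -/
theorem exists_single_ne_zero_of_ne_zero (ψ : (S → K) →ₗ[K] K) (hψ : ψ ≠ 0) :
    ∃ x : S, ψ (fun y => if x = y then 1 else 0) ≠ 0 := by
  by_contra h
  push Not at h
  apply hψ
  refine LinearMap.ext fun v => ?_
  rw [LinearMap.pi_apply_eq_sum_univ ψ v, LinearMap.zero_apply]
  exact Finset.sum_eq_zero fun x _ => by rw [h x, smul_zero]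

/-- **Generic constants.** Finitely many non-zero `K`-linear functionals on `K^S` have a common
non-zero at a point of `ℂ^S ⊆ K^S` (`K ⊇ ℂ` a field). -/
theorem exists_complex_point_forall_ne_zero [Algebra ℂ K] {Q : Type*} [Fintype Q]
    (ψ : Q → ((S → K) →ₗ[K] K)) (hψ : ∀ q, ψ q ≠ 0) :
    ∃ w : S → ℂ, ∀ q, ψ q (fun x => algebraMap ℂ K (w x)) ≠ 0 := by
  classical
  haveI : CharZero K := charZero_of_injective_algebraMap (algebraMap ℂ K).injective
  choose xq hxq using fun q => exists_single_ne_zero_of_ne_zero (ψ q) (hψ q)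
  -- standard vectors of `ℂ^S`
  let E : Q → S → ℂ := fun q y => if xq q = y then 1 else 0
  have hE : ∀ q, (fun y => algebraMap ℂ K (E q y)) = fun y => if xq q = y then 1 else 0 := by
    intro q; funext y; by_cases h : xq q = y <;> simp [E, h]
  let e : Q → ℕ := fun q => (Fintype.equivFin Q q : ℕ)
  have he : Function.Injective e := fun i i' h => (Fintype.equivFin Q).injective (Fin.ext h)
  -- `P q₀ (s) = ψ q₀ (∑_q s ^ (e q) • E q)` is a non-zero polynomial in `s`
  let P : Q → Polynomial K := fun q₀ => ∑ q, Polynomial.C (ψ q₀ fun y => algebraMap ℂ K (E q y)) *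
    Polynomial.X ^ e q
  have hP_coeff : ∀ q₀, (P q₀).coeff (e q₀) = ψ q₀ (fun y => algebraMap ℂ K (E q₀ y)) := by
    intro q₀
    simp only [P, Polynomial.finsetSum_coeff, Polynomial.coeff_C_mul, Polynomial.coeff_X_pow]
    rw [Finset.sum_eq_single q₀ (fun q _ hq => by rw [if_neg (fun h => hq (he h.symm)), mul_zero])
      (fun h => absurd (Finset.mem_univ q₀) h), if_pos rfl, mul_one]
  have hP_ne : ∀ q₀, P q₀ ≠ 0 := fun q₀ hP0 => by
    have := hP_coeff q₀
    rw [hP0, Polynomial.coeff_zero, hE] at this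
    exact hxq q₀ this.symm
  have hP_eval : ∀ q₀ (s : ℂ), (P q₀).eval (algebraMap ℂ K s) =
      ψ q₀ (fun y => algebraMap ℂ K (∑ q, s ^ e q * E q y)) := by
    intro q₀ s
    have hfun : (fun y => algebraMap ℂ K (∑ q, s ^ e q * E q y)) =
        ∑ q, (algebraMap ℂ K s) ^ e q • fun y => algebraMap ℂ K (E q y) := by
      funext y
      simp only [map_sum, map_mul, map_pow, Finset.sum_apply, Pi.smul_apply, smul_eq_mul]
    rw [hfun, map_sum]
    simp only [P, Polynomial.eval_finsetSum, Polynomial.eval_mul, Polynomial.eval_C,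
      Polynomial.eval_pow, Polynomial.eval_X, map_smul, smul_eq_mul]
    exact Finset.sum_congr rfl fun q _ => mul_comm _ _
  let bad : Finset K := Finset.univ.biUnion fun q₀ => (P q₀).roots.toFinset
  obtain ⟨k, hk⟩ := Infinite.exists_notMem_finset
    (bad.preimage (Nat.cast : ℕ → K) Nat.cast_injective.injOn)
  refine ⟨fun y => ∑ q, (k : ℂ) ^ e q * E q y, fun q₀ h0 => hk (Finset.mem_preimage.mpr ?_)⟩
  have hroot : ((k : ℕ) : K) ∈ (P q₀).roots.toFinset := by
    rw [Multiset.mem_toFinset, Polynomial.mem_roots (hP_ne q₀), Polynomial.IsRoot.def,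
      show ((k : ℕ) : K) = algebraMap ℂ K (k : ℂ) by simp, hP_eval, h0]
  exact Finset.mem_biUnion.mpr ⟨q₀, Finset.mem_univ _, hroot⟩

end Avoid

end Summit.MatrixMultiplication.MatrixMultiplication.Theorems.GraphEquations

end
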